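import Mathlib
import Summits.QuantumFields.QCD.Theorems.PauliWegnerSeaPhaseQuenchedFlavourDecayGramMomentIntegrableR1
import Literature.MathematicalPhysics.QuantumFieldTheory.QCDWickMinorMeasurability

/-!
# Pion row-norm moments from the `r = 1` Gram moments
(crux stmt-QuantumFields-9151 `PauliWegnerSea.PhaseQuenchedFlavourDecay`, line `crossing-split-integrability`,
lead c5 — registered stub `stub_pionNormMoment_of_gramMoments`)

Hypothesis ("GramMoments"): one exponent `q > 1/2` and, for every `r`, a constant `C_r` bounding — eventually
in `k` and for all tori of side `2S+1 ≥ 2L_k+1` — the phase-quenched `q`-th moments of the principal `r × r`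
minors `Re det((G Gᴴ)[I,I])` of `G = (diracMatrix U m(k))⁻¹`, together with their integrability under
`qcdLatticeMeasure`.  Conclusion: the same `q` and the constant `12^q · 12 · C_1` bound the `q`-th moment of the
full flavour-`f` row norm square at the site `x`, `Σ_{a,i} Σ_{w,b,j} ‖G((f,x,a,i),(f,w,b,j))‖²`.

Proof: at `r = 1` and `I ≡ (f,(x,a,i))` the `1 × 1` minor is the diagonal Gram entry
`Re (G Gᴴ)(p,p) = Σ_y ‖G(p,y)‖²` (`re_mul_conjTranspose_apply_self`), and only the flavour-`f` indices `y`
survive (`inv_diracMatrix_apply_of_ne'`), so it is exactly the `(a,i)` row norm square; then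
`(Σ_{a,i} t_{ai})^q ≤ 12^q Σ_{a,i} t_{ai}^q` for the `12` non-negative colour–spin terms.
-/

noncomputable section

namespace Summit.QuantumFields.QCD.Cruxes.PhaseQuenchedFlavourDecay.CrossingSplitIntegrability

open scoped BigOperators ENNReal ComplexConjugate
open MeasureTheory Filter Set Matrix
open Literature.MathematicalPhysics.QuantumFieldTheory Literature.MathematicalPhysics.QuantumLattice
  Literature.Probability.LatticeModels

/-- Elementary: for non-negative `f` and `0 < q`, `(Σ_{i∈s} f i)^q ≤ (#s)^q · Σ_{i∈s} (f i)^q`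
(bound the sum by `#s ·` its largest term). -/
theorem rpow_sum_le_card_rpow_mul_sum_rpow {ι' : Type*} (s : Finset ι') (f : ι' → ℝ)
    (hf : ∀ i ∈ s, 0 ≤ f i) {q : ℝ} (hq : 0 < q) :
    (∑ i ∈ s, f i) ^ q ≤ (s.card : ℝ) ^ q * ∑ i ∈ s, f i ^ q := by
  rcases s.eq_empty_or_nonempty with rfl | hne
  · simp [Real.zero_rpow hq.ne']
  obtain ⟨j, hj, hmax⟩ := s.exists_max_image f hne
  have hsum : ∑ i ∈ s, f i ≤ (s.card : ℝ) * f j := by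
    have h := Finset.sum_le_card_nsmul s f (f j) hmax
    rwa [nsmul_eq_mul] at h
  have h0 : 0 ≤ ∑ i ∈ s, f i := Finset.sum_nonneg hf
  calc (∑ i ∈ s, f i) ^ q ≤ ((s.card : ℝ) * f j) ^ q := Real.rpow_le_rpow h0 hsum hq.le
    _ = (s.card : ℝ) ^ q * f j ^ q := Real.mul_rpow (Nat.cast_nonneg _) (hf j hj)
    _ ≤ (s.card : ℝ) ^ q * ∑ i ∈ s, f i ^ q := by
        gcongr
        exact Finset.single_le_sum (f := fun i => f i ^ q) (fun i hi => Real.rpow_nonneg (hf i hi) _) hj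

variable {Nf L : ℕ} [NeZero L]

/-- The `1 × 1` Gram minor at the row `(f,(x,a,i))` is the flavour-`f` row norm square:
`Re det((G Gᴴ)[p,p]) = Σ_{w,b,j} ‖G((f,x,a,i),(f,w,b,j))‖²` (off-flavour entries vanish). -/
theorem re_det_gramR1_eq_rowNormSq (U : GaugeConfig 4 L SU3) (mq : Fin Nf → ℝ) (f : Fin Nf)
    (x : TorusSite 4 L) (a : Fin 3) (i : Fin 4) :
    (Matrix.of fun _ _ : Fin 1 =>
        ((diracMatrix U mq)⁻¹ * ((diracMatrix U mq)⁻¹).conjTranspose)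
          (quarkEquiv (f, (x, a, i))) (quarkEquiv (f, (x, a, i)))).det.re =
      ∑ w : TorusSite 4 L, ∑ b : Fin 3, ∑ j : Fin 4,
        ‖(diracMatrix U mq)⁻¹ (quarkEquiv (f, (x, a, i))) (quarkEquiv (f, (w, b, j)))‖ ^ 2 := by
  rw [Matrix.det_fin_one, Matrix.of_apply, re_mul_conjTranspose_apply_self,
    ← Equiv.sum_comp (quarkEquiv (Nf := Nf) (L := L)), Fintype.sum_prod_type,
    Finset.sum_eq_single_of_mem f (Finset.mem_univ f)]
  · simp only [Fintype.sum_prod_type]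
  · intro g _ hgf
    refine Finset.sum_eq_zero fun y _ => ?_
    rw [inv_diracMatrix_apply_of_ne' U mq (Ne.symm hgf), norm_zero]
    simp

/-- **Pointwise-in-the-parameters form.** On a torus of side `L`, at coupling `β` and masses `mq`: if for every row
`I : Fin 1 → QuarkVar` the `q`-th power (`0 < q`) of the `1 × 1` Gram minor is integrable with phase-quenched mean
`≤ C`, then the `q`-th power of the flavour-`f` row norm square at `x` is integrable with mean `≤ 12^q (12 C)`. -/
theorem pionNormMoment_of_gramR1 {q : ℝ} (hq : 0 < q) (β : ℝ) (mq : Fin Nf → ℝ) (C : ℝ)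
    (h : ∀ I : Fin 1 → QuarkVar Nf L,
      Integrable (fun U : GaugeConfig 4 L SU3 =>
        (Matrix.of fun a b : Fin 1 =>
          ((diracMatrix U mq)⁻¹ * ((diracMatrix U mq)⁻¹).conjTranspose)
            (quarkEquiv (I a)) (quarkEquiv (I b))).det.re ^ q) (qcdLatticeMeasure L β mq) ∧
      qcdPhaseQuenchedExpect β L mq (fun U : GaugeConfig 4 L SU3 =>
        (Matrix.of fun a b : Fin 1 =>
          ((diracMatrix U mq)⁻¹ * ((diracMatrix U mq)⁻¹).conjTranspose)
            (quarkEquiv (I a)) (quarkEquiv (I b))).det.re ^ q) ≤ C)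
    (f : Fin Nf) (x : TorusSite 4 L) :
    Integrable (fun U : GaugeConfig 4 L SU3 =>
        (∑ a : Fin 3, ∑ i : Fin 4, ∑ w : TorusSite 4 L, ∑ b : Fin 3, ∑ j : Fin 4,
          ‖(diracMatrix U mq)⁻¹ (quarkEquiv (f, (x, a, i))) (quarkEquiv (f, (w, b, j)))‖ ^ 2) ^ q)
        (qcdLatticeMeasure L β mq) ∧
      qcdPhaseQuenchedExpect β L mq (fun U : GaugeConfig 4 L SU3 =>
        (∑ a : Fin 3, ∑ i : Fin 4, ∑ w : TorusSite 4 L, ∑ b : Fin 3, ∑ j : Fin 4,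
          ‖(diracMatrix U mq)⁻¹ (quarkEquiv (f, (x, a, i))) (quarkEquiv (f, (w, b, j)))‖ ^ 2) ^ q) ≤
        (12 : ℝ) ^ q * (12 * C) := by
  -- the `r = 1` data at the twelve rows `(f,(x,a,i))`
  have hI : ∀ (a : Fin 3) (i : Fin 4),
      Integrable (fun U : GaugeConfig 4 L SU3 =>
        (Matrix.of fun _ _ : Fin 1 =>
          ((diracMatrix U mq)⁻¹ * ((diracMatrix U mq)⁻¹).conjTranspose)
            (quarkEquiv (f, (x, a, i))) (quarkEquiv (f, (x, a, i)))).det.re ^ q) (qcdLatticeMeasure L β mq) ∧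
      qcdPhaseQuenchedExpect β L mq (fun U : GaugeConfig 4 L SU3 =>
        (Matrix.of fun _ _ : Fin 1 =>
          ((diracMatrix U mq)⁻¹ * ((diracMatrix U mq)⁻¹).conjTranspose)
            (quarkEquiv (f, (x, a, i))) (quarkEquiv (f, (x, a, i)))).det.re ^ q) ≤ C :=
    fun a i => h fun _ => (f, (x, a, i))
  -- abbreviate the row norm squares `t a i U`
  set t : Fin 3 → Fin 4 → GaugeConfig 4 L SU3 → ℝ := fun a i U =>
    ∑ w : TorusSite 4 L, ∑ b : Fin 3, ∑ j : Fin 4,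
      ‖(diracMatrix U mq)⁻¹ (quarkEquiv (f, (x, a, i))) (quarkEquiv (f, (w, b, j)))‖ ^ 2 with ht
  have hgram : ∀ (a : Fin 3) (i : Fin 4) (U : GaugeConfig 4 L SU3),
      (Matrix.of fun _ _ : Fin 1 =>
          ((diracMatrix U mq)⁻¹ * ((diracMatrix U mq)⁻¹).conjTranspose)
            (quarkEquiv (f, (x, a, i))) (quarkEquiv (f, (x, a, i)))).det.re = t a i U :=
    fun a i U => re_det_gramR1_eq_rowNormSq U mq f x a i
  simp_rw [hgram] at hI
  have ht0 : ∀ a i U, 0 ≤ t a i U := fun a i U =>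
    Finset.sum_nonneg fun w _ => Finset.sum_nonneg fun b _ => Finset.sum_nonneg fun j _ => by positivity
  -- the target integrand is `(Σ_{a,i} t a i U)^q`
  show Integrable (fun U => (∑ a, ∑ i, t a i U) ^ q) (qcdLatticeMeasure L β mq) ∧
    qcdPhaseQuenchedExpect β L mq (fun U => (∑ a, ∑ i, t a i U) ^ q) ≤ (12 : ℝ) ^ q * (12 * C)
  -- pointwise bound by `12^q Σ_{a,i} (t a i U)^q`
  have hbound : ∀ U, (∑ a, ∑ i, t a i U) ^ q ≤ (12 : ℝ) ^ q * ∑ a, ∑ i, t a i U ^ q := by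
    intro U
    have h1 := rpow_sum_le_card_rpow_mul_sum_rpow (Finset.univ : Finset (Fin 3 × Fin 4))
      (fun p => t p.1 p.2 U) (fun p _ => ht0 p.1 p.2 U) hq
    rw [Fintype.sum_prod_type' fun a i => t a i U, Fintype.sum_prod_type' fun a i => t a i U ^ q] at h1
    have hcard : ((Finset.univ : Finset (Fin 3 × Fin 4)).card : ℝ) = 12 := by simp
    rwa [hcard] at h1
  have hsumInt : Integrable (fun U => (12 : ℝ) ^ q * ∑ a, ∑ i, t a i U ^ q) (qcdLatticeMeasure L β mq) :=
    (integrable_finsetSum _ fun a _ => integrable_finsetSum _ fun i _ => (hI a i).1).const_mul _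
  -- measurability of the target integrand
  have hmeas : AEStronglyMeasurable (fun U => (∑ a, ∑ i, t a i U) ^ q) (qcdLatticeMeasure L β mq) := by
    refine (Measurable.pow_const ?_ _).aestronglyMeasurable
    refine Finset.measurable_sum _ fun a _ => Finset.measurable_sum _ fun i _ => ?_
    refine Finset.measurable_sum _ fun w _ => Finset.measurable_sum _ fun b _ =>
      Finset.measurable_sum _ fun j _ => ?_
    exact (measurable_inv_diracMatrix_apply (S := L) mq _ _).norm.pow_const _
  have hInt : Integrable (fun U => (∑ a, ∑ i, t a i U) ^ q) (qcdLatticeMeasure L β mq) := by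
    refine hsumInt.mono' hmeas (Eventually.of_forall fun U => ?_)
    rw [Real.norm_eq_abs, abs_of_nonneg (Real.rpow_nonneg
      (Finset.sum_nonneg fun a _ => Finset.sum_nonneg fun i _ => ht0 a i U) _)]
    exact hbound U
  refine ⟨hInt, ?_⟩
  -- the mean: `∫ (Σ t)^q ≤ 12^q Σ_{a,i} ∫ (t a i)^q ≤ 12^q · 12 C`
  rw [qcdPhaseQuenchedExpect_eq_integral_qcdLatticeMeasure]
  simp_rw [qcdPhaseQuenchedExpect_eq_integral_qcdLatticeMeasure] at hI
  calc ∫ U, (∑ a, ∑ i, t a i U) ^ q ∂(qcdLatticeMeasure L β mq)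
      ≤ ∫ U, (12 : ℝ) ^ q * ∑ a, ∑ i, t a i U ^ q ∂(qcdLatticeMeasure L β mq) :=
        integral_mono hInt hsumInt hbound
    _ = (12 : ℝ) ^ q * ∑ a, ∑ i, ∫ U, t a i U ^ q ∂(qcdLatticeMeasure L β mq) := by
        rw [integral_const_mul, integral_finsetSum _ fun a _ => integrable_finsetSum _ fun i _ => (hI a i).1]
        refine congrArg _ (Finset.sum_congr rfl fun a _ => ?_)
        exact integral_finsetSum _ fun i _ => (hI a i).1
    _ ≤ (12 : ℝ) ^ q * ∑ _a : Fin 3, ∑ _i : Fin 4, C := by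
        refine mul_le_mul_of_nonneg_left ?_ (Real.rpow_nonneg (by norm_num) _)
        exact Finset.sum_le_sum fun a _ => Finset.sum_le_sum fun i _ => (hI a i).2
    _ = (12 : ℝ) ^ q * (12 * C) := by
        congr 1
        simp only [Finset.sum_const, Finset.card_univ, Fintype.card_fin, nsmul_eq_mul, Nat.cast_ofNat]
        ring

/-- **stub `stub_pionNormMoment_of_gramMoments` (registered stub of crux stmt-QuantumFields-9151, line
`crossing-split-integrability`)**: the `r = 1` instance of `GramMoments` bounds, with the same exponent `q > 1/2`
and the constant `12^q · 12 · C_1`, the phase-quenched `q`-th moment of the flavour-`f` row norm square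
`Σ_{a,i,w,b,j} ‖G((f,x,a,i),(f,w,b,j))‖²` of `G = (diracMatrix U m(k))⁻¹`, uniformly along the
regularisation. -/
theorem stub_pionNormMoment_of_gramMoments : ∀ (Nf : ℕ) (reg : QCDRegularisation Nf) (m : Fin Nf → ℝ),
    (∃ q : ℝ, 1 / 2 < q ∧ ∀ r : ℕ, ∃ C : ℝ, ∀ᶠ k in atTop, ∀ S : ℕ, reg.L k ≤ S →
      ∀ I : Fin r → QuarkVar Nf (2 * S + 1),
        Integrable (fun U : GaugeConfig 4 (2 * S + 1) SU3 => (Matrix.of fun a b : Fin r =>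
          ((diracMatrix U fun fl => reg.mcrit k + reg.a k * m fl / reg.Zm k)⁻¹ *
            ((diracMatrix U fun fl => reg.mcrit k + reg.a k * m fl / reg.Zm k)⁻¹).conjTranspose)
              (quarkEquiv (I a)) (quarkEquiv (I b))).det.re ^ q)
          (qcdLatticeMeasure (2 * S + 1) (reg.β k) fun fl => reg.mcrit k + reg.a k * m fl / reg.Zm k) ∧
        qcdPhaseQuenchedExpect (reg.β k) (2 * S + 1) (fun fl => reg.mcrit k + reg.a k * m fl / reg.Zm k)
          (fun U : GaugeConfig 4 (2 * S + 1) SU3 => (Matrix.of fun a b : Fin r =>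
            ((diracMatrix U fun fl => reg.mcrit k + reg.a k * m fl / reg.Zm k)⁻¹ *
              ((diracMatrix U fun fl => reg.mcrit k + reg.a k * m fl / reg.Zm k)⁻¹).conjTranspose)
                (quarkEquiv (I a)) (quarkEquiv (I b))).det.re ^ q) ≤ C) →
    ∃ q : ℝ, 1 / 2 < q ∧ ∃ C : ℝ, ∀ᶠ k in atTop, ∀ S : ℕ, reg.L k ≤ S →
      ∀ (f : Fin Nf) (x : TorusSite 4 (2 * S + 1)),
        Integrable (fun U : GaugeConfig 4 (2 * S + 1) SU3 =>
          (∑ a : Fin 3, ∑ i : Fin 4, ∑ w : TorusSite 4 (2 * S + 1), ∑ b : Fin 3, ∑ j : Fin 4,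
            ‖(diracMatrix U fun fl => reg.mcrit k + reg.a k * m fl / reg.Zm k)⁻¹
              (quarkEquiv (f, (x, a, i))) (quarkEquiv (f, (w, b, j)))‖ ^ 2) ^ q)
          (qcdLatticeMeasure (2 * S + 1) (reg.β k) fun fl => reg.mcrit k + reg.a k * m fl / reg.Zm k) ∧
        qcdPhaseQuenchedExpect (reg.β k) (2 * S + 1) (fun fl => reg.mcrit k + reg.a k * m fl / reg.Zm k)
          (fun U : GaugeConfig 4 (2 * S + 1) SU3 =>
            (∑ a : Fin 3, ∑ i : Fin 4, ∑ w : TorusSite 4 (2 * S + 1), ∑ b : Fin 3, ∑ j : Fin 4,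
              ‖(diracMatrix U fun fl => reg.mcrit k + reg.a k * m fl / reg.Zm k)⁻¹
                (quarkEquiv (f, (x, a, i))) (quarkEquiv (f, (w, b, j)))‖ ^ 2) ^ q) ≤ C := by
  intro Nf reg m hGram
  obtain ⟨q, hq, hr⟩ := hGram
  obtain ⟨C, hC⟩ := hr 1
  refine ⟨q, hq, (12 : ℝ) ^ q * (12 * C), ?_⟩
  filter_upwards [hC] with k hk S hS f x
  exact pionNormMoment_of_gramR1 (by linarith) (reg.β k) _ C (hk S hS) f x

end Summit.QuantumFields.QCD.Cruxes.PhaseQuenchedFlavourDecay.CrossingSplitIntegrability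

end
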